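import Literature.Analysis.FluidPDE.PeriodicCylinderWithinCalculus
import Mathlib.Analysis.Calculus.FDeriv.Symmetric
import Mathlib.Analysis.InnerProductSpace.Trace
import HarnessLib

/-!
# The inversion in the wall of the cylinder and the reflected velocity field

Analysis/FluidPDE support file on the discharge path of the named fact
`Literature.Analysis.FluidPDE.ShirotaYanagisawa1993_periodicCylinderLogDivCurlEstimate`
(`Ferrari1993LogEstimateReduction.lean`; Shirota–Yanagisawa 1993, (15) p. 80; Ferrari 1993,
Cor. 1 (31) p. 286). Fourth file of the plan described in `LogLipschitzKernelBounds.lean`. The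
printed proofs treat the curved wall `{r = 1}` through Green matrices of the div–curl system
(Solonnikov; Ferrari Thm 4) or boundary-fitted coordinates (Shirota–Yanagisawa p. 81); the tree's
discharge instead **reflects the velocity across the wall** by the inversion in the cylinder,

* `cylInversion y = y_z e_z + y_h / r²` (`r = cylRadius y`, `y_h = horizontalProj y`), which fixes
  the wall pointwise, exchanges `{r > 1}` and `{0 < r < 1}` (`cylRadius (cylInversion y) = r⁻¹`)
  and has derivative
  `D(cylInversion)(y) h = h − h_h + r⁻² h_h − 2r⁻⁴ ⟨y_h, h⟩ y_h` (`fderiv_cylInversion_apply`),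
  a **self-adjoint** map (`inner_fderiv_cylInversion_comm`) of **trace one**
  (`sum_inner_fderiv_cylInversion`: `3 − 2 + 2r⁻² − 2r⁻⁴ r² = 1`, i.e. the inversion is
  harmonic) whose square is `1 + (r⁻⁴ − 1) P_h` (`fderiv_cylInversion_apply_apply`) and which is
  the reflection `1 − 2 e_r ⊗ e_r` on the wall;
* the **reflected field** `reflectedField v y = D(cylInversion)(y) (v (cylInversion y))` — the
  pull-back of the one-form `v♭` by the inversion —, which on the wall equals `v` as soon as `v`
  is tangential (`reflectedField_eq_of_wall`), and whose derivative is
  `D(reflectedField v)(y) = S (Dv(Φy)) S + (k ↦ D²Φ(y)(k) v(Φy))`, `S = DΦ(y)`, `Φ = cylInversion`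
  (`hasFDerivAt_reflectedField`).

Since pull-back commutes with the exterior derivative, the antisymmetric part of
`D(reflectedField v)` is the pull-back of that of `Dv` — here: the second-derivative term is
symmetric (`inner_fderiv_fderiv_cylInversion_comm`, from the symmetry of second derivatives and
the self-adjointness of `DΦ`), so that
`⟨Du eⱼ, eᵢ⟩ − ⟨Du eᵢ, eⱼ⟩ = ⟨Dv(Φy) S eⱼ, S eᵢ⟩ − ⟨Dv(Φy) S eᵢ, S eⱼ⟩` (`antisymm_fderiv_reflectedField`),
bounded by `6 ‖curl v (Φy)‖ (1 + 3r⁻²)²` (`abs_antisymm_fderiv_reflectedField_le`): the reflected vorticity is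
bounded by the vorticity. The trace (divergence) has no zeroth-order term either, because the
trace of `D²Φ(y)(·) V` is the derivative along `V` of the constant `tr DΦ ≡ 1`
(`sum_inner_fderiv_fderiv_cylInversion`), and its first-order term is
`tr(Dv(Φy) S²) = div v (Φy) + (r⁻⁴ − 1)(∂₀v₀ + ∂₁v₁)(Φy)`; for a divergence-free `v` this gives
the **divergence defect** `|Σ_c ⟨Du e_c, e_c⟩| ≤ 2 |r⁻⁴ − 1| ‖Dv(Φy)‖`
(`abs_sum_inner_fderiv_reflectedField_le`, with `|r⁻⁴ − 1| ≤ 15(r − 1)` for `1 ≤ r ≤ 2`,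
`abs_inv_pow_four_sub_one_le`), which vanishes linearly at the wall — the property that
makes the reflection argument work in `L^∞` (the defect is integrated against `|x − y|⁻³` and
`|r⁻⁴ − 1| ≲ r − 1 ≤ |x − y|` for `x` inside). All statements here are pointwise calculus.

## Mathlib / tree search

Tree (used): `horizontalProj`, `horizontalProjL`, `norm_horizontalProj`, `cylBasis`,
`inner_cylBasis_left/right`, `cylRadius_sq`, `eR`, `frontier_unitCylinder`,
`VectorCalculus.divergence_eq_sum_inner_fderiv`, `curl`; nothing on reflections across the wall
(`lean search 'inversion|reflect' in FluidPDE`: `AxisymmetricReflection` is the reflection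
`z ↦ −z`). Mathlib (used): `HasFDerivAt.clm_apply`, `HasFDerivAt.smul`, `HasFDerivAt.norm_sq`,
`HasDerivAt.comp_hasFDerivAt` (`hasDerivAt_inv`), `ContDiffAt.isSymmSndFDerivAt`,
`ContDiffAt.fderiv_right`, `HasFDerivAt.inner`, `HasFDerivAt.unique`,
`LinearMap.trace_eq_sum_inner`, `LinearMap.trace_mul_comm`.

## References

* T. Shirota, T. Yanagisawa, Proc. Japan Acad. 69 (1993) 77–82, p. 81 (the boundary is flattened
  by admissible boundary coordinates; tangential derivatives satisfy the same boundary value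
  problem). [ShirotaYanagisawa1993]
* A. B. Ferrari, Comm. Math. Phys. 155 (1993) 277–294, proof of Prop. 1 (boundary estimate,
  pp. 289–292). [Ferrari1993]
-/

noncomputable section

open MeasureTheory Set Function Filter Metric Real WithLp
open _root_.Topology
open scoped NNReal ENNReal RealInnerProductSpace ContDiff

namespace Literature.Analysis.FluidPDE

/-- Local notation for physical space `ℝ³ = EuclideanSpace ℝ (Fin 3)`. -/
local notation "ℝ³" => EuclideanSpace ℝ (Fin 3)

/-! ### Horizontal algebra -/

/-- `r² = ‖y_h‖²`. [folklore] -/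
theorem cylRadius_sq_eq_norm_sq (y : ℝ³) : cylRadius y ^ 2 = ‖horizontalProj y‖ ^ 2 := by
  rw [norm_horizontalProj]

/-- The horizontal projection is idempotent. [folklore] -/
@[simp] theorem horizontalProj_horizontalProj (y : ℝ³) :
    horizontalProj (horizontalProj y) = horizontalProj y := by
  ext i; fin_cases i <;> simp [horizontalProj_apply_eq]

/-- The horizontal projection is self-adjoint: `⟨y_h, h⟩ = ⟨y, h_h⟩ = y₀h₀ + y₁h₁`. [folklore] -/
theorem inner_horizontalProj_left (y h : ℝ³) : ⟪horizontalProj y, h⟫ = y 0 * h 0 + y 1 * h 1 := by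
  rw [horizontalProj_eq_add_cylBasis, inner_add_left, real_inner_smul_left, real_inner_smul_left,
    inner_cylBasis_left, inner_cylBasis_left]

/-- `⟨h, y_h⟩ = y₀h₀ + y₁h₁`. [folklore] -/
theorem inner_horizontalProj_right (h y : ℝ³) : ⟪h, horizontalProj y⟫ = y 0 * h 0 + y 1 * h 1 := by
  rw [real_inner_comm, inner_horizontalProj_left]

/-- `⟨y_h, h_h⟩ = ⟨y_h, h⟩`. [folklore] -/
theorem inner_horizontalProj_horizontalProj (y h : ℝ³) :
    ⟪horizontalProj y, horizontalProj h⟫ = ⟪horizontalProj y, h⟫ := by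
  rw [inner_horizontalProj_left, inner_horizontalProj_left]
  simp

/-- `⟨y_h, y_h⟩ = r²`. [folklore] -/
theorem inner_horizontalProj_horizontalProj_self (y : ℝ³) : ⟪horizontalProj y, horizontalProj y⟫ = cylRadius y ^ 2 := by
  rw [real_inner_self_eq_norm_sq, norm_horizontalProj]

/-- `⟨y_h, y⟩ = r²`. [folklore] -/
theorem inner_horizontalProj_left_self (y : ℝ³) : ⟪horizontalProj y, y⟫ = cylRadius y ^ 2 := by
  rw [← inner_horizontalProj_horizontalProj, inner_horizontalProj_horizontalProj_self]

/-- The vertical part `h − h_h = h₂ e₂`. [folklore] -/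
theorem sub_horizontalProj_eq (h : ℝ³) : h - horizontalProj h = h 2 • cylBasis 2 := by
  ext i; fin_cases i <;> simp [horizontalProj_apply_eq, cylBasis_apply]

/-- `‖h − h_h‖ ≤ ‖h‖`. [folklore] -/
theorem norm_sub_horizontalProj_le (h : ℝ³) : ‖h - horizontalProj h‖ ≤ ‖h‖ := by
  rw [sub_horizontalProj_eq, norm_smul, norm_cylBasis, mul_one, Real.norm_eq_abs]
  have := PiLp.norm_apply_le (p := 2) h 2
  rwa [Real.norm_eq_abs] at this

/-- `‖h_h‖ ≤ ‖h‖`. [folklore] -/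
theorem norm_horizontalProj_le (h : ℝ³) : ‖horizontalProj h‖ ≤ ‖h‖ := by
  rw [norm_horizontalProj, cylRadius, EuclideanSpace.norm_eq]
  refine Real.sqrt_le_sqrt ?_
  simp only [Fin.sum_univ_three, Real.norm_eq_abs, sq_abs]
  nlinarith [sq_nonneg (h 2)]

/-- The radial unit vector is `y_h / r`. [folklore] -/
theorem eR_eq_smul_horizontalProj (y : ℝ³) : eR y = (cylRadius y)⁻¹ • horizontalProj y := rfl

/-! ### The inversion -/

/-- **The inversion in the wall of the cylinder**, `Φ(y) = y_z e_z + y_h / r²`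
(`r = cylRadius y`): it fixes `{r = 1}` pointwise and exchanges `{r > 1}` with `{0 < r < 1}`.
Junk value `y_z e_z` on the axis. [folklore] -/
def cylInversion (y : ℝ³) : ℝ³ :=
  y - horizontalProj y + (cylRadius y ^ 2)⁻¹ • horizontalProj y

/-- Unfolding `cylInversion`. [folklore] -/
theorem cylInversion_apply (y : ℝ³) :
    cylInversion y = y - horizontalProj y + (cylRadius y ^ 2)⁻¹ • horizontalProj y := rfl

/-- The horizontal part of the inverted point: `(Φ y)_h = y_h / r²`. [folklore] -/
theorem horizontalProj_cylInversion (y : ℝ³) :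
    horizontalProj (cylInversion y) = (cylRadius y ^ 2)⁻¹ • horizontalProj y := by
  rw [cylInversion_apply, map_add, map_sub, map_smul, horizontalProj_horizontalProj, sub_self, zero_add]

/-- The axial coordinate is unchanged: `(Φ y)₂ = y₂`. [folklore] -/
@[simp] theorem cylInversion_apply_two (y : ℝ³) : cylInversion y 2 = y 2 := by
  simp [cylInversion_apply]

/-- **The inverted radius**: `cylRadius (Φ y) = r⁻¹` off the axis. [folklore] -/
theorem cylRadius_cylInversion {y : ℝ³} (hy : cylRadius y ≠ 0) :
    cylRadius (cylInversion y) = (cylRadius y)⁻¹ := by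
  have hr : 0 < cylRadius y := lt_of_le_of_ne (cylRadius_nonneg y) (Ne.symm hy)
  rw [← norm_horizontalProj, horizontalProj_cylInversion, norm_smul, norm_inv, norm_pow,
    Real.norm_eq_abs, abs_of_pos hr, norm_horizontalProj]
  field_simp

/-- **The wall is fixed**: `Φ y = y` when `r = 1`. [folklore] -/
theorem cylInversion_eq_self_of_wall {y : ℝ³} (hy : cylRadius y = 1) : cylInversion y = y := by
  rw [cylInversion_apply, hy, one_pow, inv_one, one_smul, sub_add_cancel]

/-- The inversion maps the exterior `{r > 1}` into the open cylinder. [folklore] -/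
theorem cylInversion_mem_unitCylinder {y : ℝ³} (hy : 1 < cylRadius y) :
    cylInversion y ∈ (unitCylinder : Set ℝ³) := by
  rw [SetLike.mem_coe, mem_unitCylinder, cylRadius_cylInversion (by linarith)]
  exact inv_lt_one_of_one_lt₀ hy

/-- The inversion maps `{r ≥ 1}` into the closed cylinder `{r ≤ 1}`. [folklore] -/
theorem cylInversion_mem_closure_unitCylinder {y : ℝ³} (hy : 1 ≤ cylRadius y) :
    cylInversion y ∈ closure (unitCylinder : Set ℝ³) := by
  rw [closure_unitCylinder, mem_setOf_eq, cylRadius_cylInversion (by linarith)]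
  exact inv_le_one_of_one_le₀ hy

/-- Distance moved by the inversion: `‖Φ y − y‖ = r − r⁻¹` for `r ≥ 1` — at most `2(r − 1)`.
[folklore] -/
theorem norm_cylInversion_sub_le {y : ℝ³} (hy : 1 ≤ cylRadius y) :
    ‖cylInversion y - y‖ ≤ 2 * (cylRadius y - 1) := by
  have hr : 0 < cylRadius y := by linarith
  have e : cylInversion y - y = ((cylRadius y ^ 2)⁻¹ - 1) • horizontalProj y := by
    rw [cylInversion_apply, sub_smul, one_smul]; abel
  rw [e, norm_smul, norm_horizontalProj, Real.norm_eq_abs, abs_of_nonpos (by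
    rw [sub_nonpos]; exact inv_le_one_of_one_le₀ (by nlinarith)), neg_sub]
  rw [show (1 - (cylRadius y ^ 2)⁻¹) * cylRadius y = (cylRadius y ^ 2 - 1) / cylRadius y by
    field_simp, div_le_iff₀ hr]
  nlinarith

/-! ### The derivative of the inversion -/

/-- `y ↦ r(y)²` has derivative `h ↦ 2⟨y_h, h⟩`. [folklore] -/
theorem hasFDerivAt_cylRadius_sq' (y : ℝ³) :
    HasFDerivAt (fun w : ℝ³ => cylRadius w ^ 2) (2 • (innerSL ℝ (horizontalProj y)).comp horizontalProjL) y := by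
  have h := (horizontalProjL.hasFDerivAt (x := y)).norm_sq
  have e : (fun w : ℝ³ => cylRadius w ^ 2) = fun w => ‖horizontalProjL w‖ ^ 2 := by
    funext w; rw [horizontalProjL_apply, norm_horizontalProj]
  rw [e]
  exact h

/-- **Differentiability and the derivative of the inversion** off the axis:
`DΦ(y) h = h − h_h + r⁻² h_h − 2 r⁻⁴ ⟨y_h, h⟩ y_h` (chain and product rules). [folklore] -/
theorem exists_hasFDerivAt_cylInversion {y : ℝ³} (hy : cylRadius y ≠ 0) :
    ∃ L : ℝ³ →L[ℝ] ℝ³, HasFDerivAt cylInversion L y ∧ ∀ h : ℝ³, L h =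
      h - horizontalProj h + (cylRadius y ^ 2)⁻¹ • horizontalProj h -
        (2 * ((cylRadius y ^ 2)⁻¹) ^ 2 * ⟪horizontalProj y, h⟫) • horizontalProj y := by
  have hq : cylRadius y ^ 2 ≠ 0 := pow_ne_zero 2 hy
  have hinv := (hasDerivAt_inv hq).comp_hasFDerivAt y (hasFDerivAt_cylRadius_sq' y)
  have hsmul := hinv.smul (horizontalProjL.hasFDerivAt (x := y))
  have h := ((hasFDerivAt_id y).sub (horizontalProjL.hasFDerivAt (x := y))).add hsmul
  have e : cylInversion = fun w : ℝ³ =>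
      id w - horizontalProjL w + ((fun y : ℝ => y⁻¹) ∘ fun w : ℝ³ => cylRadius w ^ 2) w • horizontalProjL w := by
    funext w
    simp [cylInversion_apply, Function.comp]
  rw [e]
  refine ⟨_, h, fun k => ?_⟩
  simp only [add_apply, sub_apply, ContinuousLinearMap.id_apply, horizontalProjL_apply, smul_apply,
    ContinuousLinearMap.smulRight_apply, ContinuousLinearMap.comp_apply, innerSL_apply_apply, smul_eq_mul,
    nsmul_eq_mul, Nat.cast_ofNat, inner_horizontalProj_horizontalProj, Function.comp_apply]
  rw [inv_pow]
  module

/-- The inversion is differentiable off the axis. [folklore] -/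
theorem differentiableAt_cylInversion {y : ℝ³} (hy : cylRadius y ≠ 0) :
    DifferentiableAt ℝ cylInversion y := by
  obtain ⟨L, hL, -⟩ := exists_hasFDerivAt_cylInversion hy
  exact hL.differentiableAt

/-- **The derivative of the inversion, applied**:
`DΦ(y) h = h − h_h + r⁻² h_h − 2 r⁻⁴ ⟨y_h, h⟩ y_h`. [folklore] -/
theorem fderiv_cylInversion_apply {y : ℝ³} (hy : cylRadius y ≠ 0) (h : ℝ³) :
    fderiv ℝ cylInversion y h =
      h - horizontalProj h + (cylRadius y ^ 2)⁻¹ • horizontalProj h -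
        (2 * ((cylRadius y ^ 2)⁻¹) ^ 2 * ⟪horizontalProj y, h⟫) • horizontalProj y := by
  obtain ⟨L, hL, hLh⟩ := exists_hasFDerivAt_cylInversion hy
  rw [hL.fderiv, hLh]

/-- **Smoothness of the inversion** off the axis. [folklore] -/
theorem contDiffAt_cylInversion {y : ℝ³} (hy : cylRadius y ≠ 0) {n : WithTop ℕ∞} :
    ContDiffAt ℝ n cylInversion y := by
  have hq : cylRadius y ^ 2 ≠ 0 := pow_ne_zero 2 hy
  have e : cylInversion = fun w : ℝ³ =>
      w - horizontalProjL w + (‖horizontalProjL w‖ ^ 2)⁻¹ • horizontalProjL w := by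
    funext w
    rw [cylInversion_apply, horizontalProjL_apply, norm_horizontalProj]
  rw [e]
  have h1 : ContDiffAt ℝ n (fun w : ℝ³ => (‖horizontalProjL w‖ ^ 2)⁻¹) y := by
    refine ContDiffAt.inv (((contDiff_norm_sq ℝ).comp horizontalProjL.contDiff).contDiffAt) ?_
    rw [horizontalProjL_apply, norm_horizontalProj]
    exact hq
  have h2 : ContDiffAt ℝ n (fun w : ℝ³ => (‖horizontalProjL w‖ ^ 2)⁻¹ • horizontalProjL w) y :=
    h1.smul horizontalProjL.contDiff.contDiffAt
  exact (contDiffAt_id.sub horizontalProjL.contDiff.contDiffAt).add h2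

/-! ### Algebra of the derivative: self-adjoint, trace one, square, reflection at the wall -/

/-- **`DΦ(y)` is self-adjoint**: `⟨DΦ(y) k, h⟩ = ⟨k, DΦ(y) h⟩`. [folklore] -/
theorem inner_fderiv_cylInversion_comm {y : ℝ³} (hy : cylRadius y ≠ 0) (k h : ℝ³) :
    ⟪fderiv ℝ cylInversion y k, h⟫ = ⟪k, fderiv ℝ cylInversion y h⟫ := by
  rw [fderiv_cylInversion_apply hy, fderiv_cylInversion_apply hy]
  simp only [inner_sub_left, inner_add_left, inner_sub_right, inner_add_right, real_inner_smul_left,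
    real_inner_smul_right, inner_horizontalProj_left, inner_horizontalProj_right]
  rw [real_inner_comm h k]
  ring

/-- `⟨DΦ(y) eᵢ, eᵢ⟩` in coordinates. [folklore] -/
theorem inner_fderiv_cylInversion_cylBasis {y : ℝ³} (hy : cylRadius y ≠ 0) (i : Fin 3) :
    ⟪fderiv ℝ cylInversion y (cylBasis i), cylBasis i⟫ =
      1 - (horizontalProj (cylBasis i)) i + (cylRadius y ^ 2)⁻¹ * (horizontalProj (cylBasis i)) i -
        2 * ((cylRadius y ^ 2)⁻¹) ^ 2 * ⟪horizontalProj y, cylBasis i⟫ * (horizontalProj y) i := by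
  rw [fderiv_cylInversion_apply hy]
  simp only [inner_sub_left, inner_add_left, real_inner_smul_left, inner_cylBasis_right]
  simp

/-- **`DΦ(y)` has trace one** (`3 − 2 + 2r⁻² − 2r⁻⁴·r² = 1`): the inversion is harmonic.
[folklore] -/
theorem sum_inner_fderiv_cylInversion {y : ℝ³} (hy : cylRadius y ≠ 0) :
    ∑ i, ⟪fderiv ℝ cylInversion y (cylBasis i), cylBasis i⟫ = 1 := by
  have hq : cylRadius y ^ 2 ≠ 0 := pow_ne_zero 2 hy
  simp only [inner_fderiv_cylInversion_cylBasis hy, Fin.sum_univ_three, inner_cylBasis_right]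
  simp only [horizontalProj_apply_eq]
  simp
  have hr : cylRadius y ^ 2 = y 0 ^ 2 + y 1 ^ 2 := cylRadius_sq y
  field_simp
  rw [hr]
  ring

/-- **The square of `DΦ(y)`**: `DΦ(y) (DΦ(y) h) = h + (r⁻⁴ − 1) h_h`. [folklore] -/
theorem fderiv_cylInversion_apply_apply {y : ℝ³} (hy : cylRadius y ≠ 0) (h : ℝ³) :
    fderiv ℝ cylInversion y (fderiv ℝ cylInversion y h) =
      h + (((cylRadius y ^ 2)⁻¹) ^ 2 - 1) • horizontalProj h := by
  have hq : cylRadius y ^ 2 ≠ 0 := pow_ne_zero 2 hy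
  have hr : cylRadius y ^ 2 = y 0 ^ 2 + y 1 ^ 2 := cylRadius_sq y
  rw [fderiv_cylInversion_apply hy, fderiv_cylInversion_apply hy]
  simp only [map_sub, map_add, map_smul, horizontalProj_horizontalProj, sub_self, zero_add,
    inner_horizontalProj_left]
  rw [hr] at hq ⊢
  ext i
  fin_cases i <;> simp [horizontalProj_apply_eq] <;> field_simp <;> ring

/-- **On the wall `DΦ` is the reflection in the tangent plane**:
`DΦ(y) h = h − 2⟨y_h, h⟩ y_h` for `r = 1`. [folklore] -/
theorem fderiv_cylInversion_apply_of_wall {y : ℝ³} (hy : cylRadius y = 1) (h : ℝ³) :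
    fderiv ℝ cylInversion y h = h - (2 * ⟪horizontalProj y, h⟫) • horizontalProj y := by
  rw [fderiv_cylInversion_apply (by rw [hy]; exact one_ne_zero), hy]
  simp only [one_pow, inv_one, one_smul, mul_one, sub_add_cancel]

/-- **Norm bound**: `‖DΦ(y) h‖ ≤ (1 + 3r⁻²) ‖h‖`. [folklore] -/
theorem norm_fderiv_cylInversion_apply_le {y : ℝ³} (hy : cylRadius y ≠ 0) (h : ℝ³) :
    ‖fderiv ℝ cylInversion y h‖ ≤ (1 + 3 * (cylRadius y ^ 2)⁻¹) * ‖h‖ := by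
  have hr : 0 < cylRadius y := lt_of_le_of_ne (cylRadius_nonneg y) (Ne.symm hy)
  have hq : 0 < (cylRadius y ^ 2)⁻¹ := by positivity
  rw [fderiv_cylInversion_apply hy]
  have h1 : ‖h - horizontalProj h‖ ≤ ‖h‖ := norm_sub_horizontalProj_le h
  have h2 : ‖(cylRadius y ^ 2)⁻¹ • horizontalProj h‖ ≤ (cylRadius y ^ 2)⁻¹ * ‖h‖ := by
    rw [norm_smul, Real.norm_eq_abs, abs_of_pos hq]
    exact mul_le_mul_of_nonneg_left (norm_horizontalProj_le h) hq.le
  have h3 : ‖(2 * ((cylRadius y ^ 2)⁻¹) ^ 2 * ⟪horizontalProj y, h⟫) • horizontalProj y‖ ≤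
      2 * (cylRadius y ^ 2)⁻¹ * ‖h‖ := by
    rw [norm_smul, Real.norm_eq_abs, norm_horizontalProj]
    have hi : |⟪horizontalProj y, h⟫| ≤ cylRadius y * ‖h‖ := by
      have := abs_real_inner_le_norm (horizontalProj y) h
      rwa [norm_horizontalProj] at this
    rw [abs_mul, abs_of_pos (by positivity : (0 : ℝ) < 2 * ((cylRadius y ^ 2)⁻¹) ^ 2)]
    calc 2 * ((cylRadius y ^ 2)⁻¹) ^ 2 * |⟪horizontalProj y, h⟫| * cylRadius y
        ≤ 2 * ((cylRadius y ^ 2)⁻¹) ^ 2 * (cylRadius y * ‖h‖) * cylRadius y := by gcongr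
      _ = 2 * (cylRadius y ^ 2)⁻¹ * ‖h‖ := by field_simp
  calc ‖h - horizontalProj h + (cylRadius y ^ 2)⁻¹ • horizontalProj h -
        (2 * ((cylRadius y ^ 2)⁻¹) ^ 2 * ⟪horizontalProj y, h⟫) • horizontalProj y‖
      ≤ ‖h - horizontalProj h‖ + ‖(cylRadius y ^ 2)⁻¹ • horizontalProj h‖ +
          ‖(2 * ((cylRadius y ^ 2)⁻¹) ^ 2 * ⟪horizontalProj y, h⟫) • horizontalProj y‖ :=
        norm_sub_le_of_le (norm_add_le _ _) le_rfl
    _ ≤ ‖h‖ + (cylRadius y ^ 2)⁻¹ * ‖h‖ + 2 * (cylRadius y ^ 2)⁻¹ * ‖h‖ := add_le_add (add_le_add h1 h2) h3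
    _ = (1 + 3 * (cylRadius y ^ 2)⁻¹) * ‖h‖ := by ring

/-- Operator-norm form of the bound: `‖DΦ(y)‖ ≤ 1 + 3r⁻²`. [folklore] -/
theorem norm_fderiv_cylInversion_le {y : ℝ³} (hy : cylRadius y ≠ 0) :
    ‖fderiv ℝ cylInversion y‖ ≤ 1 + 3 * (cylRadius y ^ 2)⁻¹ :=
  ContinuousLinearMap.opNorm_le_bound _ (by positivity) (norm_fderiv_cylInversion_apply_le hy)

/-! ### The second derivative: symmetric, self-adjoint, trace-free -/

/-- `Φ` has `fderiv ℝ cylInversion` as its derivative off the axis. [folklore] -/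
theorem hasFDerivAt_cylInversion {y : ℝ³} (hy : cylRadius y ≠ 0) :
    HasFDerivAt cylInversion (fderiv ℝ cylInversion y) y :=
  (differentiableAt_cylInversion hy).hasFDerivAt

/-- The derivative `y ↦ DΦ(y)` is differentiable off the axis, with derivative the second
derivative `D²Φ(y)`. [folklore] -/
theorem hasFDerivAt_fderiv_cylInversion {y : ℝ³} (hy : cylRadius y ≠ 0) :
    HasFDerivAt (fderiv ℝ cylInversion) (fderiv ℝ (fderiv ℝ cylInversion) y) y := by
  have h2 : ContDiffAt ℝ 2 cylInversion y := contDiffAt_cylInversion hy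
  have h1 : ContDiffAt ℝ 1 (fderiv ℝ cylInversion) y := h2.fderiv_right le_rfl
  exact (h1.differentiableAt one_ne_zero).hasFDerivAt

/-- **Symmetry of the second derivative** of the inversion (Schwarz). [folklore] -/
theorem fderiv_fderiv_cylInversion_symm {y : ℝ³} (hy : cylRadius y ≠ 0) (k h : ℝ³) :
    fderiv ℝ (fderiv ℝ cylInversion) y k h = fderiv ℝ (fderiv ℝ cylInversion) y h k :=
  ((contDiffAt_cylInversion hy (n := 2)).isSymmSndFDerivAt (by simp)).eq k h

/-- Off the axis, `DΦ` is self-adjoint on a neighbourhood. [folklore] -/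
theorem eventually_inner_fderiv_cylInversion_comm {y : ℝ³} (hy : cylRadius y ≠ 0) (k h : ℝ³) :
    ∀ᶠ y' in 𝓝 y, ⟪fderiv ℝ cylInversion y' k, h⟫ = ⟪k, fderiv ℝ cylInversion y' h⟫ := by
  have hopen : IsOpen {w : ℝ³ | cylRadius w ≠ 0} := isOpen_ne_fun continuous_cylRadius continuous_const
  filter_upwards [hopen.mem_nhds hy] with y' hy'
  exact inner_fderiv_cylInversion_comm hy' k h

/-- **The second derivative along any direction is self-adjoint**:
`⟨D²Φ(y)(V) k, h⟩ = ⟨k, D²Φ(y)(V) h⟩` (differentiate the identity `⟨DΦ k, h⟩ = ⟨k, DΦ h⟩`).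
[folklore] -/
theorem inner_fderiv_fderiv_cylInversion_comm {y : ℝ³} (hy : cylRadius y ≠ 0) (V k h : ℝ³) :
    ⟪fderiv ℝ (fderiv ℝ cylInversion) y V k, h⟫ = ⟪k, fderiv ℝ (fderiv ℝ cylInversion) y V h⟫ := by
  have hD := hasFDerivAt_fderiv_cylInversion hy
  -- `g(y') = ⟪h, DΦ(y') k⟫ - ⟪k, DΦ(y') h⟫`
  have hgk : HasFDerivAt (fun y' : ℝ³ => fderiv ℝ cylInversion y' k)
      ((fderiv ℝ (fderiv ℝ cylInversion) y).flip k) y := by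
    have := hD.clm_apply (hasFDerivAt_const k y)
    simpa using this
  have hgh : HasFDerivAt (fun y' : ℝ³ => fderiv ℝ cylInversion y' h)
      ((fderiv ℝ (fderiv ℝ cylInversion) y).flip h) y := by
    have := hD.clm_apply (hasFDerivAt_const h y)
    simpa using this
  have h1 := ((innerSL ℝ h).hasFDerivAt).comp y hgk
  have h2 := ((innerSL ℝ k).hasFDerivAt).comp y hgh
  have hg := h1.sub h2
  -- `g` vanishes near `y`
  have hg0 : HasFDerivAt (fun y' : ℝ³ => (innerSL ℝ h) (fderiv ℝ cylInversion y' k) -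
      (innerSL ℝ k) (fderiv ℝ cylInversion y' h)) (0 : ℝ³ →L[ℝ] ℝ) y := by
    refine (hasFDerivAt_const (0 : ℝ) y).congr_of_eventuallyEq ?_
    filter_upwards [eventually_inner_fderiv_cylInversion_comm hy k h] with y' hy'
    simp only [innerSL_apply_apply]
    rw [real_inner_comm ((fderiv ℝ cylInversion y') k) h, hy', sub_self]
  have huniq := hg.unique hg0
  have happ := congrArg (fun L : ℝ³ →L[ℝ] ℝ => L V) huniq
  simp only [sub_apply, ContinuousLinearMap.comp_apply, innerSL_apply_apply,
    ContinuousLinearMap.flip_apply, zero_apply, sub_eq_zero] at happ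
  rwa [real_inner_comm (((fderiv ℝ (fderiv ℝ cylInversion) y) V) k) h] at happ

/-- **The second derivative along any direction is trace-free**:
`Σᵢ ⟨D²Φ(y)(V) eᵢ, eᵢ⟩ = 0` (differentiate the identity `Σᵢ ⟨DΦ eᵢ, eᵢ⟩ = 1`,
`sum_inner_fderiv_cylInversion`): the inversion is harmonic. [folklore] -/
theorem sum_inner_fderiv_fderiv_cylInversion {y : ℝ³} (hy : cylRadius y ≠ 0) (V : ℝ³) :
    ∑ i, ⟪fderiv ℝ (fderiv ℝ cylInversion) y V (cylBasis i), cylBasis i⟫ = 0 := by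
  have hD := hasFDerivAt_fderiv_cylInversion hy
  have hgi : ∀ i : Fin 3, HasFDerivAt (fun y' : ℝ³ => (innerSL ℝ (cylBasis i)) (fderiv ℝ cylInversion y' (cylBasis i)))
      ((innerSL ℝ (cylBasis i)).comp ((fderiv ℝ (fderiv ℝ cylInversion) y).flip (cylBasis i))) y := by
    intro i
    have h1 : HasFDerivAt (fun y' : ℝ³ => fderiv ℝ cylInversion y' (cylBasis i))
        ((fderiv ℝ (fderiv ℝ cylInversion) y).flip (cylBasis i)) y := by
      have := hD.clm_apply (hasFDerivAt_const (cylBasis i) y)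
      simpa using this
    exact ((innerSL ℝ (cylBasis i)).hasFDerivAt).comp y h1
  have hg := HasFDerivAt.sum (u := Finset.univ) fun i _ => hgi i
  have hopen : IsOpen {w : ℝ³ | cylRadius w ≠ 0} := isOpen_ne_fun continuous_cylRadius continuous_const
  have hg0 : HasFDerivAt (fun y' : ℝ³ => ∑ i, (innerSL ℝ (cylBasis i)) (fderiv ℝ cylInversion y' (cylBasis i)))
      (0 : ℝ³ →L[ℝ] ℝ) y := by
    refine (hasFDerivAt_const (1 : ℝ) y).congr_of_eventuallyEq ?_
    filter_upwards [hopen.mem_nhds hy] with y' hy'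
    simp only [innerSL_apply_apply]
    rw [← sum_inner_fderiv_cylInversion hy']
    exact Finset.sum_congr rfl fun i _ => real_inner_comm _ _
  have huniq := hg.unique hg0
  have happ := congrArg (fun L : ℝ³ →L[ℝ] ℝ => L V) huniq
  simp only [FunLike.coe_sum, Finset.sum_apply, ContinuousLinearMap.comp_apply,
    innerSL_apply_apply, ContinuousLinearMap.flip_apply, zero_apply] at happ
  rw [← happ]
  exact Finset.sum_congr rfl fun i _ => real_inner_comm _ _

/-! ### The reflected field -/

/-- **The reflected velocity field** `u(y) = DΦ(y) (v(Φ y))`, the pull-back of the one-form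
`v♭` under the inversion `Φ` (`DΦ` is self-adjoint); used on the exterior `{r > 1}`. [folklore] -/
def reflectedField (v : ℝ³ → ℝ³) (y : ℝ³) : ℝ³ :=
  fderiv ℝ cylInversion y (v (cylInversion y))

/-- Unfolding `reflectedField`. [folklore] -/
theorem reflectedField_apply (v : ℝ³ → ℝ³) (y : ℝ³) :
    reflectedField v y = fderiv ℝ cylInversion y (v (cylInversion y)) := rfl

/-- **Continuity across the wall**: on `{r = 1}` the reflected field of a tangential field is the
field itself (`DΦ = 1 − 2 e_r ⊗ e_r` there and `⟨v, e_r⟩ = 0`). [folklore] -/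
theorem reflectedField_eq_of_wall {v : ℝ³ → ℝ³} {y : ℝ³} (hy : cylRadius y = 1)
    (hv : ⟪v y, eR y⟫ = 0) : reflectedField v y = v y := by
  rw [reflectedField_apply, cylInversion_eq_self_of_wall hy, fderiv_cylInversion_apply_of_wall hy]
  have h0 : ⟪horizontalProj y, v y⟫ = 0 := by
    rw [eR_eq_smul_horizontalProj, hy, inv_one, one_smul, real_inner_comm] at hv
    exact hv
  rw [h0, mul_zero, zero_smul, sub_zero]

/-- **The derivative of the reflected field**:
`D(reflectedField v)(y) = DΦ(y) ∘ Dv(Φ y) ∘ DΦ(y) + (k ↦ D²Φ(y)(k) v(Φ y))`. [folklore] -/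
theorem hasFDerivAt_reflectedField {v : ℝ³ → ℝ³} {y : ℝ³} (hy : cylRadius y ≠ 0)
    {T : ℝ³ →L[ℝ] ℝ³} (hv : HasFDerivAt v T (cylInversion y)) :
    HasFDerivAt (reflectedField v)
      ((fderiv ℝ cylInversion y).comp (T.comp (fderiv ℝ cylInversion y)) +
        (fderiv ℝ (fderiv ℝ cylInversion) y).flip (v (cylInversion y))) y := by
  have hD := hasFDerivAt_fderiv_cylInversion hy
  have hV : HasFDerivAt (fun y' => v (cylInversion y')) (T.comp (fderiv ℝ cylInversion y)) y :=
    hv.comp y (hasFDerivAt_cylInversion hy)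
  exact hD.clm_apply hV

/-- **The antisymmetric part of the derivative of the reflected field is the pull-back of that
of `Dv`**: `⟨Du a, b⟩ − ⟨Du b, a⟩ = ⟨Dv(Φy) S a, S b⟩ − ⟨Dv(Φy) S b, S a⟩`, `S = DΦ(y)` (the
second-derivative terms cancel by `fderiv_fderiv_cylInversion_symm` and
`inner_fderiv_fderiv_cylInversion_comm`). [folklore] -/
theorem antisymm_fderiv_reflectedField {v : ℝ³ → ℝ³} {y : ℝ³} (hy : cylRadius y ≠ 0)
    {T : ℝ³ →L[ℝ] ℝ³} (hv : HasFDerivAt v T (cylInversion y)) (a b : ℝ³) :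
    ⟪fderiv ℝ (reflectedField v) y a, b⟫ - ⟪fderiv ℝ (reflectedField v) y b, a⟫ =
      ⟪T (fderiv ℝ cylInversion y a), fderiv ℝ cylInversion y b⟫ -
        ⟪T (fderiv ℝ cylInversion y b), fderiv ℝ cylInversion y a⟫ := by
  rw [(hasFDerivAt_reflectedField hy hv).fderiv]
  simp only [add_apply, ContinuousLinearMap.comp_apply, ContinuousLinearMap.flip_apply, inner_add_left]
  rw [inner_fderiv_cylInversion_comm hy, inner_fderiv_cylInversion_comm hy (T _) a,
    fderiv_fderiv_cylInversion_symm hy a, fderiv_fderiv_cylInversion_symm hy b,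
    inner_fderiv_fderiv_cylInversion_comm hy _ a b, real_inner_comm a]
  ring

/-- **The trace of the derivative of the reflected field**:
`Σᵢ ⟨Du eᵢ, eᵢ⟩ = Σᵢ ⟨Dv(Φy) (S eᵢ), S eᵢ⟩` (the second-derivative term is trace-free,
`sum_inner_fderiv_fderiv_cylInversion`). [folklore] -/
theorem sum_inner_fderiv_reflectedField {v : ℝ³ → ℝ³} {y : ℝ³} (hy : cylRadius y ≠ 0)
    {T : ℝ³ →L[ℝ] ℝ³} (hv : HasFDerivAt v T (cylInversion y)) :
    ∑ i, ⟪fderiv ℝ (reflectedField v) y (cylBasis i), cylBasis i⟫ =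
      ∑ i, ⟪T (fderiv ℝ cylInversion y (cylBasis i)), fderiv ℝ cylInversion y (cylBasis i)⟫ := by
  rw [(hasFDerivAt_reflectedField hy hv).fderiv]
  simp only [add_apply, ContinuousLinearMap.comp_apply, ContinuousLinearMap.flip_apply, inner_add_left,
    Finset.sum_add_distrib]
  have h0 : ∑ i, ⟪fderiv ℝ (fderiv ℝ cylInversion) y (cylBasis i) (v (cylInversion y)), cylBasis i⟫ = 0 := by
    rw [← sum_inner_fderiv_fderiv_cylInversion hy (v (cylInversion y))]
    exact Finset.sum_congr rfl fun i _ => by rw [fderiv_fderiv_cylInversion_symm hy]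
  rw [h0, add_zero]
  exact Finset.sum_congr rfl fun i _ => inner_fderiv_cylInversion_comm hy _ _

/-! ### Quantitative consequences: reflected vorticity and divergence defect -/

/-- **The antisymmetric part of `Dv` against the vorticity**, in coordinates:
`⟨Dv α, β⟩ − ⟨Dv β, α⟩ = ω₀(α₁β₂ − α₂β₁) + ω₁(α₂β₀ − α₀β₂) + ω₂(α₀β₁ − α₁β₀)`, `ω = curl v`
(i.e. `= ⟨ω, α × β⟩`, Majda–Bertozzi (1.24)). [folklore] -/
theorem inner_fderiv_sub_inner_fderiv_eq_curl {v : ℝ³ → ℝ³} {p : ℝ³} (α β : ℝ³) :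
    ⟪fderiv ℝ v p α, β⟫ - ⟪fderiv ℝ v p β, α⟫ =
      curl v p 0 * (α 1 * β 2 - α 2 * β 1) + curl v p 1 * (α 2 * β 0 - α 0 * β 2) +
        curl v p 2 * (α 0 * β 1 - α 1 * β 0) := by
  set D := fderiv ℝ v p with hD
  have hlin : ∀ γ : ℝ³, D γ = ∑ j, γ j • D (cylBasis j) := fun γ => by
    conv_lhs => rw [← sum_apply_smul_cylBasis γ]
    simp [map_sum, map_smul]
  rw [hlin α, hlin β]
  simp only [Fin.sum_univ_three, PiLp.inner_apply, RCLike.inner_apply, conj_trivial]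
  simp only [curl, cylBasis]
  simp
  ring

/-- `|αᵢβⱼ − αⱼβᵢ| ≤ 2‖α‖‖β‖`. [folklore] -/
theorem abs_coord_wedge_le (α β : ℝ³) (i j : Fin 3) : |α i * β j - α j * β i| ≤ 2 * ‖α‖ * ‖β‖ := by
  have ha : ∀ k, |α k| ≤ ‖α‖ := fun k => by
    have := PiLp.norm_apply_le (p := 2) α k; rwa [Real.norm_eq_abs] at this
  have hb : ∀ k, |β k| ≤ ‖β‖ := fun k => by
    have := PiLp.norm_apply_le (p := 2) β k; rwa [Real.norm_eq_abs] at this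
  calc |α i * β j - α j * β i| ≤ |α i * β j| + |α j * β i| := abs_sub _ _
    _ = |α i| * |β j| + |α j| * |β i| := by rw [abs_mul, abs_mul]
    _ ≤ ‖α‖ * ‖β‖ + ‖α‖ * ‖β‖ := add_le_add (mul_le_mul (ha i) (hb j) (abs_nonneg _) (norm_nonneg _))
        (mul_le_mul (ha j) (hb i) (abs_nonneg _) (norm_nonneg _))
    _ = 2 * ‖α‖ * ‖β‖ := by ring

/-- **The antisymmetric part of `Dv` is controlled by the vorticity**:
`|⟨Dv α, β⟩ − ⟨Dv β, α⟩| ≤ 6 ‖curl v‖ ‖α‖ ‖β‖`. [folklore] -/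
theorem abs_inner_fderiv_sub_le_curl (v : ℝ³ → ℝ³) (p α β : ℝ³) :
    |⟪fderiv ℝ v p α, β⟫ - ⟪fderiv ℝ v p β, α⟫| ≤ 6 * ‖curl v p‖ * ‖α‖ * ‖β‖ := by
  rw [inner_fderiv_sub_inner_fderiv_eq_curl]
  have hw : ∀ k, |curl v p k| ≤ ‖curl v p‖ := fun k => by
    have := PiLp.norm_apply_le (p := 2) (curl v p) k; rwa [Real.norm_eq_abs] at this
  have h1 := abs_coord_wedge_le α β 1 2
  have h2 := abs_coord_wedge_le α β 2 0
  have h3 := abs_coord_wedge_le α β 0 1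
  calc |curl v p 0 * (α 1 * β 2 - α 2 * β 1) + curl v p 1 * (α 2 * β 0 - α 0 * β 2) +
        curl v p 2 * (α 0 * β 1 - α 1 * β 0)|
      ≤ |curl v p 0 * (α 1 * β 2 - α 2 * β 1)| + |curl v p 1 * (α 2 * β 0 - α 0 * β 2)| +
          |curl v p 2 * (α 0 * β 1 - α 1 * β 0)| := abs_add_three _ _ _
    _ = |curl v p 0| * |α 1 * β 2 - α 2 * β 1| + |curl v p 1| * |α 2 * β 0 - α 0 * β 2| +
          |curl v p 2| * |α 0 * β 1 - α 1 * β 0| := by rw [abs_mul, abs_mul, abs_mul]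
    _ ≤ ‖curl v p‖ * (2 * ‖α‖ * ‖β‖) + ‖curl v p‖ * (2 * ‖α‖ * ‖β‖) +
          ‖curl v p‖ * (2 * ‖α‖ * ‖β‖) :=
        add_le_add (add_le_add (mul_le_mul (hw 0) h1 (abs_nonneg _) (norm_nonneg _))
          (mul_le_mul (hw 1) h2 (abs_nonneg _) (norm_nonneg _)))
          (mul_le_mul (hw 2) h3 (abs_nonneg _) (norm_nonneg _))
    _ = 6 * ‖curl v p‖ * ‖α‖ * ‖β‖ := by ring

/-- **The reflected vorticity is bounded by the vorticity**: for `r(y) ≠ 0` and `v` differentiable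
at `Φ y`, `|⟨Du eⱼ, eᵢ⟩ − ⟨Du eᵢ, eⱼ⟩| ≤ 6 ‖curl v (Φ y)‖ (1 + 3r⁻²)²`, `u = reflectedField v`.
[folklore] -/
theorem abs_antisymm_fderiv_reflectedField_le {v : ℝ³ → ℝ³} {y : ℝ³} (hy : cylRadius y ≠ 0)
    (hv : DifferentiableAt ℝ v (cylInversion y)) (j i : Fin 3) :
    |⟪fderiv ℝ (reflectedField v) y (cylBasis j), cylBasis i⟫ -
        ⟪fderiv ℝ (reflectedField v) y (cylBasis i), cylBasis j⟫| ≤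
      6 * ‖curl v (cylInversion y)‖ * (1 + 3 * (cylRadius y ^ 2)⁻¹) ^ 2 := by
  rw [antisymm_fderiv_reflectedField hy hv.hasFDerivAt]
  refine (abs_inner_fderiv_sub_le_curl v (cylInversion y) _ _).trans ?_
  have hS := fun k => norm_fderiv_cylInversion_apply_le hy (cylBasis k)
  simp only [norm_cylBasis, mul_one] at hS
  have h0 : 0 ≤ 6 * ‖curl v (cylInversion y)‖ := by positivity
  have hB : 0 ≤ 1 + 3 * (cylRadius y ^ 2)⁻¹ := by positivity
  calc 6 * ‖curl v (cylInversion y)‖ * ‖fderiv ℝ cylInversion y (cylBasis j)‖ *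
        ‖fderiv ℝ cylInversion y (cylBasis i)‖
      = 6 * ‖curl v (cylInversion y)‖ *
          (‖fderiv ℝ cylInversion y (cylBasis j)‖ * ‖fderiv ℝ cylInversion y (cylBasis i)‖) := by ring
    _ ≤ 6 * ‖curl v (cylInversion y)‖ * ((1 + 3 * (cylRadius y ^ 2)⁻¹) * (1 + 3 * (cylRadius y ^ 2)⁻¹)) :=
        mul_le_mul_of_nonneg_left (mul_le_mul (hS j) (hS i) (norm_nonneg _) hB) h0
    _ = 6 * ‖curl v (cylInversion y)‖ * (1 + 3 * (cylRadius y ^ 2)⁻¹) ^ 2 := by ring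

/-- **The trace of the derivative of the reflected field in coordinates**:
`Σᵢ ⟨Du eᵢ, eᵢ⟩ = Σᵢ ⟨Dv(Φy) eᵢ, eᵢ⟩ + (r⁻⁴ − 1)(⟨Dv(Φy) e₀, e₀⟩ + ⟨Dv(Φy) e₁, e₁⟩)`
(`S² = 1 + (r⁻⁴ − 1)P_h` in the horizontal block). [folklore] -/
theorem sum_inner_fderiv_reflectedField_eq {v : ℝ³ → ℝ³} {y : ℝ³} (hy : cylRadius y ≠ 0)
    {T : ℝ³ →L[ℝ] ℝ³} (hv : HasFDerivAt v T (cylInversion y)) :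
    ∑ i, ⟪fderiv ℝ (reflectedField v) y (cylBasis i), cylBasis i⟫ =
      ∑ i, ⟪T (cylBasis i), cylBasis i⟫ +
        (((cylRadius y ^ 2)⁻¹) ^ 2 - 1) * (⟪T (cylBasis 0), cylBasis 0⟫ + ⟪T (cylBasis 1), cylBasis 1⟫) := by
  have hq : cylRadius y ^ 2 ≠ 0 := pow_ne_zero 2 hy
  have hr : cylRadius y ^ 2 = y 0 ^ 2 + y 1 ^ 2 := cylRadius_sq y
  rw [sum_inner_fderiv_reflectedField hy hv]
  have hTP : T (horizontalProj y) = y 0 • T (cylBasis 0) + y 1 • T (cylBasis 1) := by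
    rw [horizontalProj_eq_add_cylBasis, map_add, map_smul, map_smul]
  simp only [Fin.sum_univ_three, fderiv_cylInversion_apply hy, map_sub, map_add, map_smul,
    horizontalProj_cylBasis_zero, horizontalProj_cylBasis_one, horizontalProj_cylBasis_two, hTP,
    inner_sub_left, inner_add_left, real_inner_smul_left, inner_sub_right, inner_add_right,
    real_inner_smul_right, inner_horizontalProj_right, inner_cylBasis_right,
    sub_self, zero_add, cylBasis_apply]
  simp
  rw [hr] at hq ⊢
  field_simp
  ring

/-- **The divergence defect of the reflected field**: for `v` differentiable and divergence free
at `Φ y` (`r(y) ≠ 0`), `|Σᵢ ⟨Du eᵢ, eᵢ⟩| ≤ 2 |r⁻⁴ − 1| ‖Dv(Φ y)‖`. [folklore] -/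
theorem abs_sum_inner_fderiv_reflectedField_le {v : ℝ³ → ℝ³} {y : ℝ³} (hy : cylRadius y ≠ 0)
    (hv : DifferentiableAt ℝ v (cylInversion y))
    (hdiv : VectorCalculus.divergence v (cylInversion y) = 0) :
    |∑ i, ⟪fderiv ℝ (reflectedField v) y (cylBasis i), cylBasis i⟫| ≤
      2 * |((cylRadius y ^ 2)⁻¹) ^ 2 - 1| * ‖fderiv ℝ v (cylInversion y)‖ := by
  rw [sum_inner_fderiv_reflectedField_eq hy hv.hasFDerivAt]
  have hdiv' : ∑ i, ⟪fderiv ℝ v (cylInversion y) (cylBasis i), cylBasis i⟫ = 0 := by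
    rw [divergence_eq_sum_inner_fderiv (EuclideanSpace.basisFun (Fin 3) ℝ)] at hdiv
    rw [← hdiv]
    refine Finset.sum_congr rfl fun i _ => ?_
    rw [real_inner_comm]
    simp [cylBasis]
  rw [hdiv', zero_add, abs_mul]
  have hT : ∀ k, |⟪fderiv ℝ v (cylInversion y) (cylBasis k), cylBasis k⟫| ≤ ‖fderiv ℝ v (cylInversion y)‖ := by
    intro k
    refine (abs_real_inner_le_norm _ _).trans ?_
    rw [norm_cylBasis, mul_one]
    have := (fderiv ℝ v (cylInversion y)).le_opNorm (cylBasis k)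
    rwa [norm_cylBasis, mul_one] at this
  calc |((cylRadius y ^ 2)⁻¹) ^ 2 - 1| *
        |⟪fderiv ℝ v (cylInversion y) (cylBasis 0), cylBasis 0⟫ + ⟪fderiv ℝ v (cylInversion y) (cylBasis 1), cylBasis 1⟫|
      ≤ |((cylRadius y ^ 2)⁻¹) ^ 2 - 1| * (‖fderiv ℝ v (cylInversion y)‖ + ‖fderiv ℝ v (cylInversion y)‖) := by
        gcongr
        exact (abs_add_le _ _).trans (add_le_add (hT 0) (hT 1))
    _ = 2 * |((cylRadius y ^ 2)⁻¹) ^ 2 - 1| * ‖fderiv ℝ v (cylInversion y)‖ := by ring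

/-- The factor of the divergence defect vanishes linearly at the wall:
`|r⁻⁴ − 1| ≤ 15 (r − 1)` for `1 ≤ r ≤ 2`. [folklore] -/
theorem abs_inv_pow_four_sub_one_le {r : ℝ} (h1 : 1 ≤ r) (h2 : r ≤ 2) :
    |((r ^ 2)⁻¹) ^ 2 - 1| ≤ 15 * (r - 1) := by
  have hr : 0 < r := by linarith
  have hr4 : 1 ≤ r ^ 4 := one_le_pow₀ h1
  have e : ((r ^ 2)⁻¹) ^ 2 - 1 = -((r ^ 4 - 1) / r ^ 4) := by field_simp; ring
  rw [e, abs_neg, abs_of_nonneg (by positivity), div_le_iff₀ (by positivity)]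
  nlinarith [mul_le_mul h2 h2 hr.le (by linarith), pow_le_pow_left₀ hr.le h2 3,
    mul_nonneg (sub_nonneg.2 h1) (by positivity : (0 : ℝ) ≤ r ^ 4)]

/-! ### Continuity of the reflected field up to the wall -/

/-- `y ↦ DΦ(y)` is continuous off the axis. [folklore] -/
theorem continuousAt_fderiv_cylInversion {y : ℝ³} (hy : cylRadius y ≠ 0) :
    ContinuousAt (fderiv ℝ cylInversion) y :=
  (hasFDerivAt_fderiv_cylInversion hy).continuousAt

/-- **The reflected field is continuous on `{r ≥ 1}`** when `v` is continuous on the closed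
cylinder. [folklore] -/
theorem continuousOn_reflectedField {v : ℝ³ → ℝ³}
    (hv : ContinuousOn v (closure (unitCylinder : Set ℝ³))) :
    ContinuousOn (reflectedField v) {y : ℝ³ | 1 ≤ cylRadius y} := by
  have hne : ∀ y ∈ {y : ℝ³ | 1 ≤ cylRadius y}, cylRadius y ≠ 0 := fun y hy => by
    rw [mem_setOf_eq] at hy; linarith
  have hS : ContinuousOn (fderiv ℝ cylInversion) {y : ℝ³ | 1 ≤ cylRadius y} := fun y hy =>
    (continuousAt_fderiv_cylInversion (hne y hy)).continuousWithinAt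
  have hΦ : ContinuousOn cylInversion {y : ℝ³ | 1 ≤ cylRadius y} := fun y hy =>
    (differentiableAt_cylInversion (hne y hy)).continuousAt.continuousWithinAt
  have hV : ContinuousOn (fun y => v (cylInversion y)) {y : ℝ³ | 1 ≤ cylRadius y} :=
    hv.comp hΦ fun y hy => cylInversion_mem_closure_unitCylinder hy
  exact hS.clm_apply hV

end Literature.Analysis.FluidPDE
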